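import Summits.QuantumAdvantage.QuantumAdvantage.Theorems.CubicForrelationNearExactIsExactTwelveDigitWeightReduction
import Summits.QuantumAdvantage.QuantumAdvantage.Theorems.CubicForrelationNearExactIsExactTwelveOddWeight

/-!
# Crux `CubicForrelation.NearExactIsExact` (stmt-QuantumAdvantage-14043) — n = 12: the EVEN case is all that is left of E1280

Certificate seat `b2b-cforr-cert` (gen 33; STAGED — to be checked once …TwelveOddWeight is built on the farm).  HONEST FRAMING: kernel-checked
bookkeeping (standard axioms) combining …TwelveDigitWeightReduction with THEOREM W (`tow_weight_ge_1280`); NOT summit progress.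

* `tdw_e_ge_1280_of_not_dvd16`: a type-O cubic whose digit class has `16 ∤ e` has `e ≡ 8 (mod 16)` (`tdw_e_mod8`) and hence `e ≥ 1280`
  by THEOREM W.
* `tdw_window_side_even_light`: for `57/64 < Φ(f,g) < 1` the side `g` is type O with `512 ≤ e ≤ 1272` AND `16 ∣ e`.
* `isolation_twelve_57_64_of_even_digit_weight` / `theta_twelve_eq_57_64_of_even_digit_weight`: E1280-EVEN ("every type-O cubic with
  `16 ∣ e` has `e ≥ 1280`") alone implies `θ₁₂ = 57/64`.
-/

set_option linter.dupNamespace false -- D-0017: single-problem summit ⇒ `QuantumAdvantage.QuantumAdvantage` by design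

noncomputable section

namespace Summit.QuantumAdvantage.QuantumAdvantage.Theorems.CubicForrelation.NearExactIsExact

open Finset
open Literature.Computability.QuantumComplexity
open Literature.Computability.QuantumComplexity.DerivativeWalsh (W)

section Even

variable (g : (Fin (6 + 6) → Bool) → Bool) (u : (Fin (6 + 6) → Bool) → ℤ)

/-- **The odd case of `E1280` is THEOREM W.**  If the digit class of a type-O cubic on 12 bits has `16 ∤ e` points, then
`e ≡ 8 (mod 16)` (`tdw_e_mod8`) and `e ≥ 1280` by `tow_weight_ge_1280`. [this work] -/
theorem tdw_e_ge_1280_of_not_dvd16 (hg : IsDegLeFun 3 g) (hu : ∀ x, W (fun y => signOf (g y)) x = (2 : ℝ) ^ 4 * (u x : ℝ))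
    (hodd : ∀ x, Odd (u x)) (h16 : ¬ (16 : ℕ) ∣ #(univ.filter fun x : Fin (6 + 6) → Bool => u x % 8 = 1 ∨ u x % 8 = 7)) :
    1280 ≤ #(univ.filter fun x : Fin (6 + 6) → Bool => u x % 8 = 1 ∨ u x % 8 = 7) := by
  have h8 := tdw_e_mod8 g u hg hu hodd
  have hQ := tdw_digitClass_cubic g u hg hu hodd
  have hset : (univ.filter fun x : Fin (6 + 6) → Bool => u x % 8 = 1 ∨ u x % 8 = 7) =
      univ.filter fun x : Fin (6 + 6) → Bool => decide (u x % 8 = 1 ∨ u x % 8 = 7) = true := by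
    simp only [decide_eq_true_eq]
  rw [hset] at h8 h16 ⊢
  refine tow_weight_ge_1280 (fun x => decide (u x % 8 = 1 ∨ u x % 8 = 7)) hQ ?_
  omega

/-- **Window ⇒ even light digit class.**  For cubic `f, g` on 12 bits with `57/64 < Φ(f,g) < 1`, the side `g` is type O with
`512 ≤ e ≤ 1272` and `16 ∣ e`. [this work] -/
theorem tdw_window_side_even_light (f g : (Fin (6 + 6) → Bool) → Bool) (hf : IsDegLeFun 3 f) (hg : IsDegLeFun 3 g)
    (hlo : (57 / 64 : ℝ) < forrelation f g) (hhi : forrelation f g < 1) :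
    ∃ u : (Fin (6 + 6) → Bool) → ℤ, (∀ x, W (fun y => signOf (g y)) x = (2 : ℝ) ^ 4 * (u x : ℝ)) ∧ (∀ x, Odd (u x)) ∧
      512 ≤ #(univ.filter fun x : Fin (6 + 6) → Bool => u x % 8 = 1 ∨ u x % 8 = 7) ∧
      #(univ.filter fun x : Fin (6 + 6) → Bool => u x % 8 = 1 ∨ u x % 8 = 7) ≤ 1272 ∧
      (16 : ℕ) ∣ #(univ.filter fun x : Fin (6 + 6) → Bool => u x % 8 = 1 ∨ u x % 8 = 7) := by
  obtain ⟨u, hu, hodd, hge, hle⟩ := tdw_window_side_light f g hf hg hlo hhi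
  refine ⟨u, hu, hodd, hge, hle, ?_⟩
  by_contra h16
  have he := tdw_e_ge_1280_of_not_dvd16 g u hg hu hodd h16
  omega

/-- **`E1280-even ⇒ isolation at 57/64` (conditional packaging).** [this work] -/
theorem isolation_twelve_57_64_of_even_digit_weight
    (H : ∀ (g : (Fin (6 + 6) → Bool) → Bool) (u : (Fin (6 + 6) → Bool) → ℤ), IsDegLeFun 3 g →
      (∀ x, W (fun y => signOf (g y)) x = (2 : ℝ) ^ 4 * (u x : ℝ)) → (∀ x, Odd (u x)) →
      (16 : ℕ) ∣ #(univ.filter fun x : Fin (6 + 6) → Bool => u x % 8 = 1 ∨ u x % 8 = 7) →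
      1280 ≤ #(univ.filter fun x : Fin (6 + 6) → Bool => u x % 8 = 1 ∨ u x % 8 = 7)) :
    ∀ f g : (Fin 12 → Bool) → Bool, IsDegLeFun 3 f → IsDegLeFun 3 g →
      (57 / 64 : ℝ) < forrelation f g → forrelation f g = 1 := by
  refine isolation_twelve_57_64_of_digit_weight fun g u hg hu hodd => ?_
  by_cases h16 : (16 : ℕ) ∣ #(univ.filter fun x : Fin (6 + 6) → Bool => u x % 8 = 1 ∨ u x % 8 = 7)
  · exact H g u hg hu hodd h16
  · exact tdw_e_ge_1280_of_not_dvd16 g u hg hu hodd h16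

/-- **`E1280-even ⇒ θ₁₂ = 57/64` (conditional packaging).** [this work] -/
theorem theta_twelve_eq_57_64_of_even_digit_weight
    (H : ∀ (g : (Fin (6 + 6) → Bool) → Bool) (u : (Fin (6 + 6) → Bool) → ℤ), IsDegLeFun 3 g →
      (∀ x, W (fun y => signOf (g y)) x = (2 : ℝ) ^ 4 * (u x : ℝ)) → (∀ x, Odd (u x)) →
      (16 : ℕ) ∣ #(univ.filter fun x : Fin (6 + 6) → Bool => u x % 8 = 1 ∨ u x % 8 = 7) →
      1280 ≤ #(univ.filter fun x : Fin (6 + 6) → Bool => u x % 8 = 1 ∨ u x % 8 = 7)) :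
    IsLeast {θ : ℝ | ∀ f g : (Fin 12 → Bool) → Bool, IsDegLeFun 3 f → IsDegLeFun 3 g →
      θ < forrelation f g → forrelation f g = 1} (57 / 64) :=
  ⟨isolation_twelve_57_64_of_even_digit_weight H, fun θ hθ => theta_twelve_bounds.2 θ hθ⟩

end Even

end Summit.QuantumAdvantage.QuantumAdvantage.Theorems.CubicForrelation.NearExactIsExact

end
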